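import Summits.SmoothPoincare4.SmoothPoincare4.Theorems.ConvexBisectionPlanarBisectionExistsSeamConnected
import Summits.SmoothPoincare4.SmoothPoincare4.Theorems.AcyclicBisectionExists.Negative.Gluing
import Literature.Geometry.Symplectic.SteinMorsePerturbation
import Literature.Geometry.Symplectic.SteinMorseIndex

/-!
# `PlanarBisectionExists` — support: both halves of a Stein bisection of a connected 4-manifold
# are connected

Completion of the "gluing graph" picture of
`Theorems/ConvexBisectionPlanarBisectionExistsSeamConnected.lean` for the item
`Summit.SmoothPoincare4.SmoothPoincare4.Theses.ConvexBisection.PlanarBisectionExists`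
(stmt-SmoothPoincare4-10512): in a Stein bisection `M = e₁ W₁ ∪ e₂ W₂` of a CONNECTED `M` along a
common contact seam, not only the seam but **both halves are connected**, unconditionally — the
gluing graph (vertices = components of the halves, edges = components of the seam) is a single
edge.  So every such witness has the intended shape `Σ = W₁ ∪_Γ W̄₂` with `W₁, W₂, Γ` connected;
this removes the hypothesis "acyclic" from the sibling's `Witness.connectedSpace₁_of_acyclic`
(`Theorems/AcyclicBisectionExists/Negative/Sphere.lean`).

Proof: the seam `Γ` is connected (`isConnected_seam_of_gompf`, its Gompf-fact hypothesis supplied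
from the tree's proved bricks `SteinStructure.exists_isMorseAdapted_levi_pos` +
`SteinStructure.isHandlebodyOfIndexLE_two_of_isMorseAdapted`); the boundary images
`e₁(∂W₁ ∩ C)` of the components `C` of `W₁` are nonempty (same bricks, via
`isPreconnected_boundary_inter_connectedComponent`), closed, pairwise disjoint and cover `Γ`; two
components would split `Γ` into two disjoint nonempty closed pieces.

* `connectedSpace₁`, `connectedSpace₂` — the halves of a witness over a connected `M` are connected;
* `connectedSpace₁_of_homotopyEquiv`, `connectedSpace₂_of_homotopyEquiv` — over `M ≃ₕ S⁴`.
-/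

noncomputable section

-- the prescribed namespace `Summit.<P>.<Sub>.…` duplicates `SmoothPoincare4` (P = Sub)
set_option linter.dupNamespace false

open scoped Manifold ContDiff Topology ContinuousMap
open Set Function
open Literature.Geometry.Symplectic Literature.Topology.FourManifolds

namespace Summit.SmoothPoincare4.SmoothPoincare4.Theorems.PlanarBisectionExists

open Summit.SmoothPoincare4.SmoothPoincare4.Theses.ConvexBisection
open Summit.SmoothPoincare4.SmoothPoincare4.Theorems.AcyclicBisectionExists.Negative

variable {M : Type} [TopologicalSpace M] [T2Space M] [SecondCountableTopology M]
  [ChartedSpace (EuclideanSpace ℝ (Fin 4)) M]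

/-- **The first half of a Stein bisection of a connected 4-manifold is connected.**  If `W₁` had
two components `C ∌ w`, the boundary images `K = e₁(∂W₁ ∩ C)` and `L = e₁(∂W₁ ∖ C)` would be
disjoint closed sets covering the seam, both meeting it (every component of a compact Stein
domain has nonempty boundary), contradicting the connectedness of the seam. [folklore] -/
theorem connectedSpace₁ [ConnectedSpace M] (B : Witness M) : ConnectedSpace B.W₁ := by
  -- Gompf 1998, Thm. 1.3 (a), from the tree's proved bricks
  have hG : Gompf1998_thm13_indexLE_two := fun W _ _ _ _ _ _ h => by
    obtain ⟨S⟩ := h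
    obtain ⟨g, hg, hconv⟩ := S.exists_isMorseAdapted_levi_pos
    exact S.isHandlebodyOfIndexLE_two_of_isMorseAdapted hg hconv
  haveI := B.t2Space₁; haveI := B.secondCountableTopology₁
  haveI := locallyConnectedSpace_of_chartedSpace B.W₁
  obtain ⟨⟨w₀⟩, -⟩ := B.halves_nonempty
  have hΓ : IsConnected B.seam := isConnected_seam_of_gompf hG B
  rw [connectedSpace_iff_connectedComponent]
  refine ⟨w₀, ?_⟩
  by_contra hne
  obtain ⟨w, hw⟩ : ∃ w, w ∉ connectedComponent w₀ :=
    not_forall.1 fun h => hne (eq_univ_of_forall h)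
  set C : Set B.W₁ := connectedComponent w₀ with hC
  set K : Set M := B.e₁ '' ((𝓡∂ 4).boundary B.W₁ ∩ C) with hK
  set L : Set M := B.e₁ '' ((𝓡∂ 4).boundary B.W₁ ∩ Cᶜ) with hL
  have hbd : IsClosed ((𝓡∂ 4).boundary B.W₁) :=
    ModelWithCorners.isClosed_boundary (I := 𝓡∂ 4) (M := B.W₁) (n := ∞) (by simp)
  have hKc : IsClosed K :=
    ((hbd.inter isClosed_connectedComponent).isCompact.image B.continuous_e₁).isClosed
  have hLc : IsClosed L :=
    ((hbd.inter isOpen_connectedComponent.isClosed_compl).isCompact.image B.continuous_e₁).isClosed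
  have hcover : B.seam ⊆ K ∪ L := by
    rw [B.seam_eq_image₁]
    rintro _ ⟨x, hx, rfl⟩
    by_cases hxC : x ∈ C
    · exact Or.inl ⟨x, ⟨hx, hxC⟩, rfl⟩
    · exact Or.inr ⟨x, ⟨hx, hxC⟩, rfl⟩
  have hKsub : K ⊆ B.seam := by
    rw [B.seam_eq_image₁]; exact image_mono inter_subset_left
  have hLsub : L ⊆ B.seam := by
    rw [B.seam_eq_image₁]; exact image_mono inter_subset_left
  have hKne : (B.seam ∩ K).Nonempty := by
    obtain ⟨p, hp⟩ := ((isPreconnected_boundary_inter_connectedComponent hG B.J₁ w₀).2).image B.e₁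
    exact ⟨p, hKsub hp, hp⟩
  have hLne : (B.seam ∩ L).Nonempty := by
    obtain ⟨p, hp⟩ := ((isPreconnected_boundary_inter_connectedComponent hG B.J₁ w).2).image B.e₁
    have hsub : (𝓡∂ 4).boundary B.W₁ ∩ connectedComponent w ⊆ (𝓡∂ 4).boundary B.W₁ ∩ Cᶜ := by
      refine inter_subset_inter_right _ fun x hx hxC => hw ?_
      have h1 : connectedComponent w = connectedComponent x := connectedComponent_eq hx
      have h2 : connectedComponent w₀ = connectedComponent x := connectedComponent_eq hxC
      show w ∈ connectedComponent w₀
      rw [h2, ← h1]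
      exact mem_connectedComponent
    exact ⟨p, hLsub (image_mono hsub hp), image_mono hsub hp⟩
  have hdisj : K ∩ L = ∅ := by
    apply eq_empty_of_forall_notMem
    rintro p ⟨⟨x, ⟨-, hxC⟩, rfl⟩, ⟨y, ⟨-, hyC⟩, hxy⟩⟩
    exact hyC (B.injective_e₁ hxy ▸ hxC)
  obtain ⟨p, -, hp⟩ := isPreconnected_closed_iff.1 hΓ.isPreconnected K L hKc hLc hcover hKne hLne
  rw [hdisj] at hp
  exact hp

/-- **The second half of a Stein bisection of a connected 4-manifold is connected** (swap the
halves). [folklore] -/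
theorem connectedSpace₂ [ConnectedSpace M] (B : Witness M) : ConnectedSpace B.W₂ :=
  connectedSpace₁ B.swap

/-- Over a homotopy 4-sphere both halves of every witness are connected: the first … [folklore] -/
theorem connectedSpace₁_of_homotopyEquiv (e : M ≃ₕ (Metric.sphere (0 : EuclideanSpace ℝ (Fin 5)) 1))
    (B : Witness M) : ConnectedSpace B.W₁ := by
  haveI : PathConnectedSpace (Metric.sphere (0 : EuclideanSpace ℝ (Fin 5)) 1) :=
    pathConnectedSpace_sphere_four
  haveI : PathConnectedSpace M := pathConnectedSpace_of_homotopyEquiv e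
  exact connectedSpace₁ B

/-- … and the second. [folklore] -/
theorem connectedSpace₂_of_homotopyEquiv (e : M ≃ₕ (Metric.sphere (0 : EuclideanSpace ℝ (Fin 5)) 1))
    (B : Witness M) : ConnectedSpace B.W₂ :=
  connectedSpace₁_of_homotopyEquiv e B.swap

end Summit.SmoothPoincare4.SmoothPoincare4.Theorems.PlanarBisectionExists
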